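import Summits.HodgeConjecture.HodgeConjecture.Theorems.LimitExtensionHodgeFourfolds
import Literature.AlgebraicGeometry.HodgeTheory.GysinKernelSplit
import Literature.AlgebraicGeometry.HodgeTheory.LefschetzOneOneOfGAGA
import Literature.AlgebraicGeometry.HodgeTheory.HodgeRiemannPolarizability
import Literature.AlgebraicGeometry.HodgeTheory.ComplexConjugationHolds
import Literature.NumberTheory.Transcendental.DeRhamTheoremMultiplicative

/-!
# Route LimitExtension · `HodgeFourfolds` (stmt-HodgeConjecture-10866) — the same reduction on the leaves of the fact DAG

Companion of `Theorems/LimitExtensionHodgeFourfolds` (`hodgeFourfolds_of`): the route decl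
`HodgeFourfolds` from the LEAVES of the tree's fact DAG, the intermediate reductions being theorems
of `Literature/` — GAGA for line bundles (⟹ Lefschetz `(1,1)`), hard Lefschetz on fourfolds,
Deligne Hodge III Prop. 8.2.7 (⟹ Cor. 8.2.8), polarizability of the Hodge structures of smooth
projective varieties (⟹ Voisin 2025 Cor. 2.12, with the PROVED real Hodge models and de Rham
theorem), and the route's open support item `SpecialisationOfAlgebraicity`. CONDITIONAL on exactly
these five hypotheses.
-/

noncomputable section

open Literature.AlgebraicGeometry Literature.AlgebraicGeometry.Motives
open Literature.AlgebraicGeometry.HodgeTheory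

namespace Summit.HodgeConjecture.HodgeConjecture.Theorems

/-- **`HodgeFourfolds` from the LEAVES of the tree's fact DAG** (the trust base of
`hodgeFourfolds_of` after the reductions already proved in `Literature/`): GAGA for line bundles
(`hG` ⟹ Lefschetz `(1,1)`, `lefschetzOneOne_rational_of_serreGAGA`), hard Lefschetz on fourfolds
(`hHL`), Deligne's Hodge III Prop. 8.2.7 (`h827` ⟹ Cor. 8.2.8,
`Deligne1974_ker_restrictCompl_eq_iSup_range_complexGysin_holds_of`), the polarizability of the Hodge
structures of smooth projective varieties (`hpol` ⟹ Voisin 2025 Cor. 2.12,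
`Voisin2025_hodgeClass_lift_complexGysin_holds_of` fed the proved real Hodge models
`exists_isReal_hodgeModel_holds` and de Rham's theorem `exists_deRhamIsoFamily_holds`), and the
route's specialisation lemma (`hS`, item stmt-HodgeConjecture-2998).
[cite: SerreGAGA1956, n° 20 Prop. 18] [cite: VoisinHodgeI2002, Thm. 6.25, Thm. 6.32 and Thm. 11.30]
[cite: DeligneHodgeIII1974, Prop. 8.2.7 and Cor. 8.2.8] [cite: Voisin2025, Prop. 2.11 and Cor. 2.12] -/
theorem hodgeFourfolds_of_leaves (hG : serreGAGA_lineCocycle_iso_cartierDivisorCocycle)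
    (hHL : ∀ X : SchemeOver ℂ, nonempty_hardLefschetzNFold 4 X)
    (h827 : Deligne1974_ker_pullback_eq_ker_pullback_resolution)
    (hpol : smoothProjective_hodgeStructure_isPolarizable)
    (hS : Theses.LimitExtension.SpecialisationOfAlgebraicity) :
    Theses.LimitExtension.HodgeFourfolds :=
  hodgeFourfolds_of (lefschetzOneOne_rational_of_serreGAGA hG) hHL
    (Deligne1974_ker_restrictCompl_eq_iSup_range_complexGysin_holds_of h827)
    (Voisin2025_hodgeClass_lift_complexGysin_holds_of exists_isReal_hodgeModel_holds
      (fun E _ _ _ ↦ Literature.NumberTheory.Transcendental.exists_deRhamIsoFamily_holds E) hpol)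
    hS

end Summit.HodgeConjecture.HodgeConjecture.Theorems

end
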